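import Summits.BirchSwinnertonDyer.BirchSwinnertonDyer.Theses.ByReductionTypeAtTwo
import Summits.BirchSwinnertonDyer.BirchSwinnertonDyer.Theorems.ByReductionTypeAtTwoRankOneAtTwoOneDoorLawDefs
import Summits.BirchSwinnertonDyer.BirchSwinnertonDyer.Theorems.ByReductionTypeAtTwoRankOneAtTwoBigImageOddLocalOneDoorGlue
import Summits.BirchSwinnertonDyer.BirchSwinnertonDyer.Theorems.ByReductionTypeAtTwoRankOneAtTwoBigImageOddLocalOneDoorValue
import Summits.BirchSwinnertonDyer.BirchSwinnertonDyer.Theorems.ByReductionTypeAtTwoRankOneAtTwoBigImageOddLocalOneDoorTamagawa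
import HarnessLib

/-!
# LINE v7.4 `one_door_law` for the crux `RankOneAtTwoBigImageOddLocal` (stmt-BirchSwinnertonDyer-23715) — -an g10, MEMO-an v1.20 AN-27;
# v7.2 = lead bsd-line-fkl-p1 g6: carriers / Props RE-POINTED to the tree (p610929), glue stub DISCHARGED (p611607);
# v7.3 = lead g6: the VALUE stub RESHAPED into (V1) 2-converse / (V2) rank-0 BSD₂ of the Sel₂-trivial twist / (V3) Tamagawa at the door primes, its glue DISCHARGED;
# v7.4 = width seat fkl-p2 g6: (V3) `stub_doorTamagawa` PROVED (p616165) — sorries 7 → 6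

Answer to the lead's PICKED (g5) objection (1) against `egg_kolyvagin_two` v6 («residual `S_shaTwoOnSlice` has no plan; three
door laws each need `Ш[2] = 0`»): ONE door law with the `Ш(E)` side explicit covers the whole slice, SHA-CORNER included,
and the line has NO residual stub.  Six registered stubs, composition kernel-checked, sorries only in `stub_*`:

* `S_pub` (v6 verbatim) — Gross–Zagier, Kolyvagin, `K`-rationality of Heegner points (tree theorem), GZK over `ℚ`, modularity.
* `DoorIndexLawAtTwo` (AN-27, THE LOAD-BEARING STUB; conjecture = rank-one `BSD₂` in Heegner-index currency, `L`-free):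
  `2m + [Δ<0] = ord₂ #Ш(E)[2^∞] + t + 2s` for every `Sel₂`-trivialising door field.  Census ENGINE L (j299986: 11/11; j300076).
* `DoorTwistValueAtTwo` (rank-`0` side of the twin: `2`-converse + `BSD₂(E^{(d)})`; modulo the converse = the route's own four
  `…RankZeroAtTwo` cruxes at the twin, which has the same reduction type at `2`).
* `DoorSupplyAtTwo` (theorem on paper, Mazur–Rubin 2010 §3 + Chebotarev inside the Heegner classes).
* `S_manin` (v6 verbatim; odd parametrisation constant: theorem for `4 ∤ N`, open for `4 ∣ N`).
* `S_doorGlue` (M-sized Lean over the PROVED tree door `P2.bsdp_two_iff_of_heegner_rankOne`: `n = 1 + [Δ>0]`, `k = 1` and `t_K` odd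
  from `E(K)[2] = 0`, `w = 2`, `|u| = 1` (tree theorem `u_eq_one_or_eq_neg_one_of_smul_quadraticTwist_of_squarefree`), `c` odd,
  `v₂ [E(K):ℤP] = m`; the identity `3 + 2m + 0 − ([Δ>0] + 0 + 0 + 0 + 2 + (v₂c_W + t + 2s) + 0 + v₂c_W) = ord₂#Ш(E)` IS the law).
v7.2 (lead g6, 2026-08-28T07:2xZ): the carriers `DoorAdmissible` / `transpCount` / `identCount` / `HasTwoDivisibilityUpToTorsion`, the
four door Props and the plumbing Props `S_pub` / `S_manin` / `S_sliceMW` / `S_doorGlue` are now the TREE's declarations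
(`Theorems/ByReductionTypeAtTwoRankOneAtTwoOneDoorLawDefs.lean`, p610929, namespace `…Theorems.RankOneAtTwoOneDoor`, bodies =
v7.1 verbatim) and are only `open`ed here, so every registered stub keeps its name and signature text; the glue stub is
DISCHARGED by the tree theorem `RankOneAtTwoOneDoor.stub_doorGlue` (`Theorems/…RankOneAtTwoBigImageOddLocalOneDoorGlue.lean`,
p611607) — sorries 6 → 5.  D-an-37 is thereby served (no `F1Sign2/OneDoorLawAtTwo.lean` needed).
v7.3 (lead g6, 2026-08-28T08:3xZ): RESHAPE of the value stub.  `stub_doorValue : DoorTwistValueAtTwo` mixed ONE open analytic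
input with kernel-provable arithmetic; it is now DERIVED (tree theorem `RankOneAtTwoOneDoor.doorTwistValueAtTwo_of`,
`Theorems/…OneDoorValue.lean`) from three registered stubs, each ONE named statement of the tree (`…OneDoorLawDefs.lean` APPENDs
p613572 / p614035): `stub_doorConverse : DoorTwistConverseAtTwo` (V1, the rank-`0` `2`-CONVERSE «`Sel₂(E^{(d)}) = 0 ⇒
L(E^{(d)},1) ≠ 0`», OPEN in print for non-CM curves — the line's residual analytic input), `stub_doorTwistBSD : DoorTwistBSDTwoAtTwo`
(V2, rank-`0` `BSD₂` of the `Sel₂`-TRIVIAL twist — implied by the route's four rank-`0` cruxes BY NAME, tree theorem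
`doorTwistBSDTwoAtTwo_of_rankZero_cruxes`; printed for the Zhai 2016 / Cai–Li–Zhai 2019 families), `stub_doorTamagawa :
DoorTwistTamagawaAtTwo` (V3, `ord₂ ∏c_ℓ(Wd) = ord₂ ∏c_ℓ(W) + t + 2s`, Tate `I₀*` at the door primes — KERNEL-PROVABLE, the next
width target).  The `Sel₂ = 0 ⇒ rank 0 ∧ E(ℚ)[2] = 0 ∧ Ш[2^∞] = 0` bookkeeping and the rank-`0` unpacking of `BSD(Wd,2)` are
proved in `…OneDoorValue.lean`.  Stubs: 7 = `stub_pub` (PRINT) · `stub_doorIndex` (AN-27, CONJECTURE, load-bearing) ·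
`stub_doorConverse` (OPEN) · `stub_doorTwistBSD` (route rank-0 cruxes) · `stub_doorTamagawa` (kernel, to do) · `stub_doorSupply`
(theorem on paper) · `stub_manin` (open at `4 ∣ N`); glue and value DISCHARGED.
v7.4 (lead g6, 2026-08-28T08:2xZ): `stub_doorTamagawa` DISCHARGED by the width seat's UNCONDITIONAL tree theorem
`RankOneAtTwoOneDoor.stub_doorTamagawa` (`Theorems/…RankOneAtTwoBigImageOddLocalOneDoorTamagawa.lean`, p616165, fkl-p2 g6; Tate `I₀*`
exact p614342 + twist dictionary p615631).  Open stubs: 6 = `stub_pub` (PRINT) · `stub_doorIndex` (AN-27 CONJECTURE) ·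
`stub_doorConverse` (OPEN 2-converse) · `stub_doorTwistBSD` (⟸ route rank-0 cruxes) · `stub_doorSupply` (paper) · `stub_manin` (open at 4 ∣ N).
Disproof used: none on file for this crux (no `Disproof.lean` in the crux directory at 2026-08-28T06:00Z).  Dead lines avoided: the
v4–v6 residuals (`S_noEggOnSlice` ⊋ `S_negOrShaTwoOnSlice` ⊋ `S_shaTwoOnSlice`) are GONE, not renamed: the SHA-CORNER is decided by the
same stub as the three loci (`m ≥ 1` rows, census table MEMO-an v1.20 §3 P27).
-/

noncomputable section

open scoped Classical

namespace Summit.BirchSwinnertonDyer.BirchSwinnertonDyer.Cruxes.RankOneAtTwoBigImageOddLocal.OneDoorLaw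

open Literature.NumberTheory.EllipticCurves Literature.NumberTheory.EllipticCurves.ModularForms
  Summit.BirchSwinnertonDyer.Rank1Residual.F1Sign2
  Summit.BirchSwinnertonDyer.Rank1Residual.F1Sign2.TranspositionDoor
  Summit.BirchSwinnertonDyer.BirchSwinnertonDyer.Theses.ByReductionTypeAtTwo
  Summit.BirchSwinnertonDyer.BirchSwinnertonDyer.Theorems.RankOneAtTwoOneDoor

set_option autoImplicit false
set_option linter.dupNamespace false

/-! ### Carriers and door Props: the tree's (`Theorems/ByReductionTypeAtTwoRankOneAtTwoOneDoorLawDefs.lean`, p610929) —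
`DoorAdmissible`, `transpCount`, `identCount`, `HasTwoDivisibilityUpToTorsion`, `@[conjecture] DoorIndexLawAtTwo`,
`DoorDivisibilityAtTwo`, `DoorTwistValueAtTwo`, `DoorSupplyAtTwo`, `S_pub`, `S_manin`, `S_sliceMW`, `S_doorGlue` (opened above). -/

/-! ### The stubs (names and signature text unchanged from v7.1 except the value stub, reshaped in v7.3) -/

theorem stub_pub : S_pub := by sorry
theorem stub_doorIndex : DoorIndexLawAtTwo := by sorry
theorem stub_doorConverse : DoorTwistConverseAtTwo := by sorry
theorem stub_doorTwistBSD : DoorTwistBSDTwoAtTwo := by sorry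
/-- DISCHARGED (width seat fkl-p2 g6, p616165): Tate `I₀*` at the door primes, unconditional. -/
theorem stub_doorTamagawa : DoorTwistTamagawaAtTwo :=
  Summit.BirchSwinnertonDyer.BirchSwinnertonDyer.Theorems.RankOneAtTwoOneDoor.stub_doorTamagawa
theorem stub_doorSupply : DoorSupplyAtTwo := by sorry
theorem stub_manin : S_manin := by sorry
/-- DERIVED (lead g6, v7.3): the value law from modularity (`stub_pub.2.2`), the `2`-converse, the rank-`0` `BSD₂` of the
`Sel₂`-trivial twist and the Tamagawa receptacle — tree theorem `RankOneAtTwoOneDoor.doorTwistValueAtTwo_of`. -/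
theorem stub_doorValue : DoorTwistValueAtTwo :=
  Summit.BirchSwinnertonDyer.BirchSwinnertonDyer.Theorems.RankOneAtTwoOneDoor.doorTwistValueAtTwo_of
    stub_pub.2.2 stub_doorConverse stub_doorTwistBSD stub_doorTamagawa
/-- DISCHARGED (lead g6, p611607): the glue is the tree theorem `RankOneAtTwoOneDoor.stub_doorGlue`. -/
theorem stub_doorGlue : S_doorGlue :=
  Summit.BirchSwinnertonDyer.BirchSwinnertonDyer.Theorems.RankOneAtTwoOneDoor.stub_doorGlue

/-- Local name for the route crux (so that the implication form `comp` is not itself a second crux-concluding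
theorem: the skeleton audit takes exactly one theorem concluding the crux BY NAME — `RankOneAtTwoBigImageOddLocal_of`). -/
def Crux : Prop :=
  Summit.BirchSwinnertonDyer.BirchSwinnertonDyer.Theses.ByReductionTypeAtTwo.RankOneAtTwoBigImageOddLocal

/-- Kernel-checked composition in implication form: the six stub STATEMENTS give the child crux — one door, no case
split; the only logic here is GZK (`mordellWeilRank = analyticRank` for analytic rank `≤ 1`, out of `S_pub`). -/
theorem comp :
    S_pub → DoorIndexLawAtTwo → DoorTwistValueAtTwo → DoorSupplyAtTwo → S_manin → S_doorGlue → Crux := by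
  intro h1 h2 h3 h4 h5 h6 W _ _ hCM hsurj hT hc hr
  have hrk : W.mordellWeilRank = 1 := by
    have h := (h1.2.1 W (le_of_eq hr)).1
    rw [h, hr]
  exact h6 h1 h2 h3 h4 h5 W hCM hsurj hT hc hr hrk

/-- THE SKELETON: the crux BY NAME (type literally the route decl) from exactly the six registered stubs, by name,
through `comp`; no sorry of its own. -/
theorem RankOneAtTwoBigImageOddLocal_of :
    Summit.BirchSwinnertonDyer.BirchSwinnertonDyer.Theses.ByReductionTypeAtTwo.RankOneAtTwoBigImageOddLocal :=
  comp stub_pub stub_doorIndex stub_doorValue stub_doorSupply stub_manin stub_doorGlue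

end Summit.BirchSwinnertonDyer.BirchSwinnertonDyer.Cruxes.RankOneAtTwoBigImageOddLocal.OneDoorLaw

end
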